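import Summits.QuantumFields.YangMills.Theorems.ColdStartUniversalityLatticeLangevinBakryEmeryGradientBound
import Mathlib.Analysis.Calculus.FDeriv.Measurable
import HarnessLib

/-!
# Route `ColdStartUniversality` (fixed-cut-off SZZ dynamics, semigroup calculus): TIME-REGULARITY OF THE FRAME DERIVATIVES OF
# THE SEMIGROUP — `τ ↦ W_n(P_τ F)(x)` is `C¹` with derivative `W_n(P_τ 𝓛F)(x)`

Helper file (seat `ym-line-csu-p1`, g43; `--supports stmt-QuantumFields-24809`).  For ANY Markov kernel family `κ` realising the
transition laws of the SU(2) lattice Langevin (SZZ) dynamics at coupling `β'` (hypothesis `hreal`), the noise frame `σ_n` (`n = (e,ν)`,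
`W_n g = Dg[σ_n]`) and the Dynkin class (`C³`, compactly supported functions of the real link coordinates composed with `coords`):
the tree knows `P_τ(C³_c) ⊂ C³_c` (g24, Doss–Sussmann) and the backward Kolmogorov equation for the VALUES `τ ↦ P_τF(x)`; the weak
gradient bound of g29 was proved by a duality trick precisely to avoid time-derivatives of SPATIAL derivatives of the semigroup.  This
file supplies them, from three tree inputs only (Dynkin's formula in kernel form, the pointwise gradient bound
`wilson_carre_transition_le_of_hessBound_of_rep` as a UNIFORM Lipschitz bound, differentiation under the time integral):
* ★ `abs_frameDeriv_transitionRep_le` — a bound on `|W_n g'(coords y)|`, uniform over all `C¹` representatives `g'` of `κ_τ(a∘coords)`,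
  all `y` and all `τ ≤ T` (`a ∈ C⁵`);
* ★★★ `frameDeriv_transition_sub_eq_integral` — for `f ∈ C³_c`, a `C⁵_c` representative `a` of `𝓛f` on the group, and ANY families of
  `C¹` representatives `g_τ` of `κ_τ(f∘coords)` and `v_τ` of `κ_τ(a∘coords)`:
  `W_n g_(τ₂)(coords x) − W_n g_(τ₁)(coords x) = ∫_(τ₁)^(τ₂) W_n v_σ(coords x) dσ`   (`0 ≤ τ₁ ≤ τ₂`)
  (Dynkin along the one-parameter subgroup `h ↦ e^(hX)·_e x`, then `d/dh` under `∫dσ`; the integrand is measurable in `σ` because it is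
  the `h`-derivative of the jointly continuous `(σ,h) ↦ κ_σ(a∘coords)(e^(hX)·_e x)`);
(continuity and differentiability in `τ` follow in the sequel `…FrameDerivativeTimeDerivative`).  This is the regularity input for Bakry–Émery flows whose functional is NOT the carré du champ of the generator (weighted gradient
bounds, sequel files).  THEOREMS ONLY, no definition, no sorry; all [folklore] (classical backward-Kolmogorov regularity).
HONEST FRAMING: fixed-cut-off semigroup calculus; nothing K-uniform; no crux, rung or summit statement is proved; the Yang–Mills mass
gap is NOT proved.
-/

set_option autoImplicit false

noncomputable section

namespace Summit.QuantumFields.YangMills.Theorems.ColdStartUniversality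

open MeasureTheory ProbabilityTheory Matrix Complex Finset Filter Set Metric
open scoped ComplexConjugate BigOperators Matrix NNReal ENNReal Topology
open Literature.Probability.Process Literature.MathematicalPhysics.QuantumFieldTheory
open Literature.MathematicalPhysics.QuantumLattice (fundamentalRep fundamentalLatticeRep continuous_fundamentalRep fundamentalRep_apply)

variable {L : ℕ} [NeZero L]

/-! ## §1. A uniform bound on the frame derivatives of representatives of `κ_τ(a∘coords)` -/

/-- ★ **Uniform Lipschitz control of the semigroup along the noise frame.**  For `a ∈ C⁵` and `T ≥ 0` there is `M` with
`|W_n g'(coords y)| ≤ M` for every `τ ≤ T`, every `C¹` representative `g'` of `κ_τ(a∘coords)`, every frame index `n` and every `y`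
(the pointwise gradient bound `e^((2−24|β'|)τ)Γ^A(g') ≤ κ_τ(Γ^A a) ≤ sup Γ^A a`, one frame component at a time). [folklore] -/
theorem abs_frameDeriv_transitionRep_le (L : ℕ) [NeZero L] (β' : ℝ)
    (κ : ℝ≥0 → Kernel (GaugeConfig 3 L (Matrix.specialUnitaryGroup (Fin 2) ℂ))
      (GaugeConfig 3 L (Matrix.specialUnitaryGroup (Fin 2) ℂ))) [∀ t, IsMarkovKernel (κ t)]
    (hreal : ∀ (t : ℝ≥0) (x : GaugeConfig 3 L (Matrix.specialUnitaryGroup (Fin 2) ℂ))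
        (Ω : Type) [MeasurableSpace Ω] (P : Measure Ω) [IsProbabilityMeasure P]
        (W : ℝ≥0 → Ω → (Edge 3 L × NoiseIdx 2 → ℝ)) (hW : IsFlatBrownian W P)
        (U : ℝ≥0 → Ω → GaugeConfig 3 L (Matrix.specialUnitaryGroup (Fin 2) ℂ)),
        (∀ ω, U 0 ω = x) →
        (latticeLangevinDynamics (fundamentalLatticeRep 2) β').IsSolution (fundamentalRep (Fin 2))
          hW.natFiltration P W U →
        κ t x = P.map (U t))
    {a : (Edge 3 L × Fin 2 × Fin 2 × Bool → ℝ) → ℝ} (ha : ContDiff ℝ 5 a) (T : ℝ) :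
    let coords : GaugeConfig 3 L (Matrix.specialUnitaryGroup (Fin 2) ℂ) → (Edge 3 L × Fin 2 × Fin 2 × Bool → ℝ) :=
      fun V q => (fun z : ℂ => if q.2.2.2 then z.im else z.re)
        ((fundamentalRep (Fin 2) (V q.1) : Matrix (Fin 2) (Fin 2) ℂ) q.2.1 q.2.2.1)
    ∃ M : ℝ, 0 ≤ M ∧ ∀ (τ : ℝ≥0), (τ : ℝ) ≤ T → ∀ (g' : (Edge 3 L × Fin 2 × Fin 2 × Bool → ℝ) → ℝ), ContDiff ℝ 1 g' →
      (∀ x, ∫ y, a (coords y) ∂(κ τ x) = g' (coords x)) →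
      ∀ (n : Edge 3 L × NoiseIdx (fundamentalLatticeRep 2).N) (y : GaugeConfig 3 L (Matrix.specialUnitaryGroup (Fin 2) ℂ)),
        |fderiv ℝ g' (coords y) (fun q : Edge 3 L × Fin (fundamentalLatticeRep 2).N × Fin (fundamentalLatticeRep 2).N × Bool => if n.1 = q.1 then (fun z : ℂ => if q.2.2.2 then z.im else z.re) (((Real.sqrt 2 : ℂ) • ((fundamentalLatticeRep 2).lieProj (noiseDir n.2) * (fun (ee : Edge 3 L) => Matrix.of fun (i j : Fin (fundamentalLatticeRep 2).N) => ((coords y (ee, i, j, false) : ℝ) : ℂ) + ((coords y (ee, i, j, true) : ℝ) : ℂ) * Complex.I) q.1)) q.2.1 q.2.2.1) else 0)| ≤ M := by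
  intro coords
  classical
  haveI := secondCountableTopology_su2
  haveI := borelSpace_config L
  have hco : Continuous coords := continuous_coords (L := L)
  have ha2 : ContDiff ℝ 2 a := ha.of_le (by norm_num)
  -- the noise covariance and the carré du champ `Γ^A(a)`; continuity and a bound `S`
  obtain ⟨A, hA⟩ : ∃ A : GaugeConfig 3 L (Matrix.specialUnitaryGroup (Fin 2) ℂ) → (Edge 3 L × Fin 2 × Fin 2 × Bool) → (Edge 3 L × Fin 2 × Fin 2 × Bool) → ℝ, A = fun V i j =>
      ∑ n : Edge 3 L × NoiseIdx 2,
        (if n.1 = i.1 then (fun z : ℂ => if i.2.2.2 then z.im else z.re)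
          ((latticeLangevinDynamics (fundamentalLatticeRep 2) β').noise
            (matrixConfig (fundamentalRep (Fin 2)) V) i.1 n.2 i.2.1 i.2.2.1) else 0) *
        (if n.1 = j.1 then (fun z : ℂ => if j.2.2.2 then z.im else z.re)
          ((latticeLangevinDynamics (fundamentalLatticeRep 2) β').noise
            (matrixConfig (fundamentalRep (Fin 2)) V) j.1 n.2 j.2.1 j.2.2.1) else 0) := ⟨_, rfl⟩
  obtain ⟨Γa, hΓa⟩ : ∃ Γa : GaugeConfig 3 L (Matrix.specialUnitaryGroup (Fin 2) ℂ) → ℝ, Γa = fun y => ∑ i : Edge 3 L × Fin 2 × Fin 2 × Bool, ∑ j : Edge 3 L × Fin 2 × Fin 2 × Bool,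
      fderiv ℝ a (coords y) (Pi.single i 1) * fderiv ℝ a (coords y) (Pi.single j 1) * A y i j := ⟨_, rfl⟩
  -- frame dictionary: `Γ^A(φ)(y) = Σ_k (W_k φ)²`
  have hdict : ∀ (φ : (Edge 3 L × Fin 2 × Fin 2 × Bool → ℝ) → ℝ) (y : GaugeConfig 3 L (Matrix.specialUnitaryGroup (Fin 2) ℂ)), ∑ i : Edge 3 L × Fin 2 × Fin 2 × Bool, ∑ j : Edge 3 L × Fin 2 × Fin 2 × Bool,
      fderiv ℝ φ (coords y) (Pi.single i 1) * fderiv ℝ φ (coords y) (Pi.single j 1) * A y i j =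
      ∑ k : Edge 3 L × NoiseIdx (fundamentalLatticeRep 2).N, fderiv ℝ φ (coords y) (fun q : Edge 3 L × Fin (fundamentalLatticeRep 2).N × Fin (fundamentalLatticeRep 2).N × Bool => if k.1 = q.1 then (fun z : ℂ => if q.2.2.2 then z.im else z.re) (((Real.sqrt 2 : ℂ) • ((fundamentalLatticeRep 2).lieProj (noiseDir k.2) * (fun (ee : Edge 3 L) => Matrix.of fun (i j : Fin (fundamentalLatticeRep 2).N) => ((coords y (ee, i, j, false) : ℝ) : ℂ) + ((coords y (ee, i, j, true) : ℝ) : ℂ) * Complex.I) q.1)) q.2.1 q.2.2.1) else 0) * fderiv ℝ φ (coords y) (fun q : Edge 3 L × Fin (fundamentalLatticeRep 2).N × Fin (fundamentalLatticeRep 2).N × Bool => if k.1 = q.1 then (fun z : ℂ => if q.2.2.2 then z.im else z.re) (((Real.sqrt 2 : ℂ) • ((fundamentalLatticeRep 2).lieProj (noiseDir k.2) * (fun (ee : Edge 3 L) => Matrix.of fun (i j : Fin (fundamentalLatticeRep 2).N) => ((coords y (ee, i, j, false) : ℝ) : ℂ) + ((coords y (ee, i, j, true) : ℝ) : ℂ)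 * Complex.I) q.1)) q.2.1 q.2.2.1) else 0) := by
    intro φ y
    rw [hA]
    exact carre_eq_sum_frameDeriv_mul L β' φ φ y
  have hΓa_cont : Continuous Γa := by
    rw [hΓa]
    have hfield : ∀ k : Edge 3 L × NoiseIdx (fundamentalLatticeRep 2).N, Continuous fun y : GaugeConfig 3 L (Matrix.specialUnitaryGroup (Fin 2) ℂ) => fderiv ℝ a (coords y) (fun q : Edge 3 L × Fin (fundamentalLatticeRep 2).N × Fin (fundamentalLatticeRep 2).N × Bool => if k.1 = q.1 then (fun z : ℂ => if q.2.2.2 then z.im else z.re) (((Real.sqrt 2 : ℂ) • ((fundamentalLatticeRep 2).lieProj (noiseDir k.2) * (fun (ee : Edge 3 L) => Matrix.of fun (i j : Fin (fundamentalLatticeRep 2).N) => ((coords y (ee, i, j, false) : ℝ) : ℂ) + ((coords y (ee, i, j, true) : ℝ) : ℂ) * Complex.I) q.1)) q.2.1 q.2.2.1) else 0) := by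
      intro k
      obtain ⟨s, -, hs, -⟩ := exists_noiseFrame L
      have e : (fun y : GaugeConfig 3 L (Matrix.specialUnitaryGroup (Fin 2) ℂ) => fderiv ℝ a (coords y) (fun q : Edge 3 L × Fin (fundamentalLatticeRep 2).N × Fin (fundamentalLatticeRep 2).N × Bool => if k.1 = q.1 then (fun z : ℂ => if q.2.2.2 then z.im else z.re) (((Real.sqrt 2 : ℂ) • ((fundamentalLatticeRep 2).lieProj (noiseDir k.2) * (fun (ee : Edge 3 L) => Matrix.of fun (i j : Fin (fundamentalLatticeRep 2).N) => ((coords y (ee, i, j, false) : ℝ) : ℂ) + ((coords y (ee, i, j, true) : ℝ) : ℂ) * Complex.I) q.1)) q.2.1 q.2.2.1) else 0)) = fun y => fderiv ℝ a (coords y) (s k (coords y)) :=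
        funext fun y => by rw [hs k (coords y)]
      rw [e]
      exact (continuous_frameDeriv (ha.of_le (by norm_num)) (s k)).comp hco
    have e : (fun y : GaugeConfig 3 L (Matrix.specialUnitaryGroup (Fin 2) ℂ) => ∑ i : Edge 3 L × Fin 2 × Fin 2 × Bool, ∑ j : Edge 3 L × Fin 2 × Fin 2 × Bool,
        fderiv ℝ a (coords y) (Pi.single i 1) * fderiv ℝ a (coords y) (Pi.single j 1) * A y i j) =
        fun y => ∑ k : Edge 3 L × NoiseIdx (fundamentalLatticeRep 2).N, fderiv ℝ a (coords y) (fun q : Edge 3 L × Fin (fundamentalLatticeRep 2).N × Fin (fundamentalLatticeRep 2).N × Bool => if k.1 = q.1 then (fun z : ℂ => if q.2.2.2 then z.im else z.re) (((Real.sqrt 2 : ℂ) • ((fundamentalLatticeRep 2).lieProj (noiseDir k.2) * (fun (ee : Edge 3 L) => Matrix.of fun (i j : Fin (fundamentalLatticeRep 2).N) => ((coords y (ee, i, j, false) : ℝ) : ℂ) + ((coords y (ee, i, j, true) : ℝ) : ℂ) * Complex.I) q.1)) q.2.1 q.2.2.1) else 0) * fderiv ℝ a (coords y) (fun q : Edge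 3 L × Fin (fundamentalLatticeRep 2).N × Fin (fundamentalLatticeRep 2).N × Bool => if k.1 = q.1 then (fun z : ℂ => if q.2.2.2 then z.im else z.re) (((Real.sqrt 2 : ℂ) • ((fundamentalLatticeRep 2).lieProj (noiseDir k.2) * (fun (ee : Edge 3 L) => Matrix.of fun (i j : Fin (fundamentalLatticeRep 2).N) => ((coords y (ee, i, j, false) : ℝ) : ℂ) + ((coords y (ee, i, j, true) : ℝ) : ℂ) * Complex.I) q.1)) q.2.1 q.2.2.1) else 0) :=
      funext fun y => hdict a y
    rw [e]
    exact continuous_finsetSum _ fun k _ => (hfield k).mul (hfield k)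
  obtain ⟨S, hS⟩ : ∃ S : ℝ, ∀ y, Γa y ≤ S := by
    obtain ⟨S, hS⟩ := isCompact_univ.exists_bound_of_continuousOn hΓa_cont.continuousOn
    exact ⟨S, fun y => (le_abs_self _).trans (by simpa [Real.norm_eq_abs] using hS y (Set.mem_univ y))⟩
  -- the constant
  refine ⟨Real.sqrt (Real.exp (|24 * |β'| - 2| * |T|) * S), Real.sqrt_nonneg _, ?_⟩
  intro τ hτT g' hg' hrep n y
  have hgb := wilson_carre_transition_le_of_hessBound_of_rep L β' (24 * |β'|) (wilson_hessBound L β') κ hreal ha τ hg' hrep y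
  -- `κ_τ(Γ^A a)(y) ≤ S`
  haveI : IsProbabilityMeasure (κ τ y) := IsMarkovKernel.isProbabilityMeasure y
  have hint : ∫ z, (∑ i : Edge 3 L × Fin 2 × Fin 2 × Bool, ∑ j : Edge 3 L × Fin 2 × Fin 2 × Bool, fderiv ℝ a (coords z) (Pi.single i 1) * fderiv ℝ a (coords z) (Pi.single j 1) * A z i j) ∂(κ τ y) ≤ S := by
    have e : (fun z => ∑ i : Edge 3 L × Fin 2 × Fin 2 × Bool, ∑ j : Edge 3 L × Fin 2 × Fin 2 × Bool, fderiv ℝ a (coords z) (Pi.single i 1) * fderiv ℝ a (coords z) (Pi.single j 1) * A z i j) = Γa := by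
      rw [hΓa]
    rw [e]
    calc ∫ z, Γa z ∂(κ τ y) ≤ ∫ _z, S ∂(κ τ y) :=
          integral_mono (integrable_of_continuous_of_compactSpace hΓa_cont _) (integrable_const _) fun z => hS z
      _ = S := by simp
  -- one frame component is dominated by the frame sum
  have hsq : (fderiv ℝ g' (coords y) (fun q : Edge 3 L × Fin (fundamentalLatticeRep 2).N × Fin (fundamentalLatticeRep 2).N × Bool => if n.1 = q.1 then (fun z : ℂ => if q.2.2.2 then z.im else z.re) (((Real.sqrt 2 : ℂ) • ((fundamentalLatticeRep 2).lieProj (noiseDir n.2) * (fun (ee : Edge 3 L) => Matrix.of fun (i j : Fin (fundamentalLatticeRep 2).N) => ((coords y (ee, i, j, false) : ℝ) : ℂ) + ((coords y (ee, i, j, true) : ℝ) : ℂ) * Complex.I) q.1)) q.2.1 q.2.2.1) else 0)) ^ 2 ≤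
      ∑ k : Edge 3 L × NoiseIdx (fundamentalLatticeRep 2).N, fderiv ℝ g' (coords y) (fun q : Edge 3 L × Fin (fundamentalLatticeRep 2).N × Fin (fundamentalLatticeRep 2).N × Bool => if k.1 = q.1 then (fun z : ℂ => if q.2.2.2 then z.im else z.re) (((Real.sqrt 2 : ℂ) • ((fundamentalLatticeRep 2).lieProj (noiseDir k.2) * (fun (ee : Edge 3 L) => Matrix.of fun (i j : Fin (fundamentalLatticeRep 2).N) => ((coords y (ee, i, j, false) : ℝ) : ℂ) + ((coords y (ee, i, j, true) : ℝ) : ℂ) * Complex.I) q.1)) q.2.1 q.2.2.1) else 0) * fderiv ℝ g' (coords y) (fun q : Edge 3 L × Fin (fundamentalLatticeRep 2).N × Fin (fundamentalLatticeRep 2).N × Bool => if k.1 = q.1 then (fun z : ℂ => if q.2.2.2 then z.im else z.re) (((Real.sqrt 2 : ℂ) • ((fundamentalLatticeRep 2).lieProj (noiseDir k.2) * (fun (ee : Edge 3 L) => Matrix.of fun (i j : Fin (fundamentalLatticeRep 2).N) => ((coords y (ee, i, j, false) : ℝ) : ℂ) + ((coords y (ee, i, j, true) : ℝ) : ℂ)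 * Complex.I) q.1)) q.2.1 q.2.2.1) else 0) := by
    rw [sq]
    exact Finset.single_le_sum (f := fun k : Edge 3 L × NoiseIdx (fundamentalLatticeRep 2).N => fderiv ℝ g' (coords y) (fun q : Edge 3 L × Fin (fundamentalLatticeRep 2).N × Fin (fundamentalLatticeRep 2).N × Bool => if k.1 = q.1 then (fun z : ℂ => if q.2.2.2 then z.im else z.re) (((Real.sqrt 2 : ℂ) • ((fundamentalLatticeRep 2).lieProj (noiseDir k.2) * (fun (ee : Edge 3 L) => Matrix.of fun (i j : Fin (fundamentalLatticeRep 2).N) => ((coords y (ee, i, j, false) : ℝ) : ℂ) + ((coords y (ee, i, j, true) : ℝ) : ℂ) * Complex.I) q.1)) q.2.1 q.2.2.1) else 0) * fderiv ℝ g' (coords y) (fun q : Edge 3 L × Fin (fundamentalLatticeRep 2).N × Fin (fundamentalLatticeRep 2).N × Bool => if k.1 = q.1 then (fun z : ℂ => if q.2.2.2 then z.im else z.re) (((Real.sqrt 2 : ℂ) • ((fundamentalLatticeRep 2).lieProj (noiseDir k.2) * (fun (ee : Edge 3 L) => Matrix.of fun (i j : Fin (fundamentalLatticeRep 2).N) =>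 ((coords y (ee, i, j, false) : ℝ) : ℂ) + ((coords y (ee, i, j, true) : ℝ) : ℂ) * Complex.I) q.1)) q.2.1 q.2.2.1) else 0))
      (fun k _ => mul_self_nonneg _) (Finset.mem_univ n)
  rw [← hdict g' y] at hsq
  -- exponential bookkeeping
  have hexp : Real.exp ((2 - 24 * |β'|) * (τ : ℝ)) * (fderiv ℝ g' (coords y) (fun q : Edge 3 L × Fin (fundamentalLatticeRep 2).N × Fin (fundamentalLatticeRep 2).N × Bool => if n.1 = q.1 then (fun z : ℂ => if q.2.2.2 then z.im else z.re) (((Real.sqrt 2 : ℂ) • ((fundamentalLatticeRep 2).lieProj (noiseDir n.2) * (fun (ee : Edge 3 L) => Matrix.of fun (i j : Fin (fundamentalLatticeRep 2).N) => ((coords y (ee, i, j, false) : ℝ) : ℂ) + ((coords y (ee, i, j, true) : ℝ) : ℂ) * Complex.I) q.1)) q.2.1 q.2.2.1) else 0)) ^ 2 ≤ S := by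
    have hA' : A = fun V i j =>
      ∑ n : Edge 3 L × NoiseIdx 2,
        (if n.1 = i.1 then (fun z : ℂ => if i.2.2.2 then z.im else z.re)
          ((latticeLangevinDynamics (fundamentalLatticeRep 2) β').noise
            (matrixConfig (fundamentalRep (Fin 2)) V) i.1 n.2 i.2.1 i.2.2.1) else 0) *
        (if n.1 = j.1 then (fun z : ℂ => if j.2.2.2 then z.im else z.re)
          ((latticeLangevinDynamics (fundamentalLatticeRep 2) β').noise
            (matrixConfig (fundamentalRep (Fin 2)) V) j.1 n.2 j.2.1 j.2.2.1) else 0) := hA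
    subst hA'
    exact le_trans (mul_le_mul_of_nonneg_left hsq (Real.exp_pos _).le) (hgb.trans hint)
  have hτ0 : 0 ≤ (τ : ℝ) := τ.coe_nonneg
  have hE : 1 ≤ Real.exp (|24 * |β'| - 2| * |T|) * Real.exp ((2 - 24 * |β'|) * (τ : ℝ)) := by
    rw [← Real.exp_add]
    refine Real.one_le_exp ?_
    have h1 : -( |24 * |β'| - 2| * (τ : ℝ)) ≤ (2 - 24 * |β'|) * (τ : ℝ) := by
      have := neg_abs_le (2 - 24 * |β'|)
      rw [abs_sub_comm] at this
      nlinarith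
    have h2 : |24 * |β'| - 2| * (τ : ℝ) ≤ |24 * |β'| - 2| * |T| :=
      mul_le_mul_of_nonneg_left (hτT.trans (le_abs_self T)) (abs_nonneg _)
    linarith
  have hsq2 : (fderiv ℝ g' (coords y) (fun q : Edge 3 L × Fin (fundamentalLatticeRep 2).N × Fin (fundamentalLatticeRep 2).N × Bool => if n.1 = q.1 then (fun z : ℂ => if q.2.2.2 then z.im else z.re) (((Real.sqrt 2 : ℂ) • ((fundamentalLatticeRep 2).lieProj (noiseDir n.2) * (fun (ee : Edge 3 L) => Matrix.of fun (i j : Fin (fundamentalLatticeRep 2).N) => ((coords y (ee, i, j, false) : ℝ) : ℂ) + ((coords y (ee, i, j, true) : ℝ) : ℂ) * Complex.I) q.1)) q.2.1 q.2.2.1) else 0)) ^ 2 ≤ Real.exp (|24 * |β'| - 2| * |T|) * S := by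
    have hx0 : 0 ≤ (fderiv ℝ g' (coords y) (fun q : Edge 3 L × Fin (fundamentalLatticeRep 2).N × Fin (fundamentalLatticeRep 2).N × Bool => if n.1 = q.1 then (fun z : ℂ => if q.2.2.2 then z.im else z.re) (((Real.sqrt 2 : ℂ) • ((fundamentalLatticeRep 2).lieProj (noiseDir n.2) * (fun (ee : Edge 3 L) => Matrix.of fun (i j : Fin (fundamentalLatticeRep 2).N) => ((coords y (ee, i, j, false) : ℝ) : ℂ) + ((coords y (ee, i, j, true) : ℝ) : ℂ) * Complex.I) q.1)) q.2.1 q.2.2.1) else 0)) ^ 2 := sq_nonneg _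
    calc (fderiv ℝ g' (coords y) (fun q : Edge 3 L × Fin (fundamentalLatticeRep 2).N × Fin (fundamentalLatticeRep 2).N × Bool => if n.1 = q.1 then (fun z : ℂ => if q.2.2.2 then z.im else z.re) (((Real.sqrt 2 : ℂ) • ((fundamentalLatticeRep 2).lieProj (noiseDir n.2) * (fun (ee : Edge 3 L) => Matrix.of fun (i j : Fin (fundamentalLatticeRep 2).N) => ((coords y (ee, i, j, false) : ℝ) : ℂ) + ((coords y (ee, i, j, true) : ℝ) : ℂ) * Complex.I) q.1)) q.2.1 q.2.2.1) else 0)) ^ 2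
        ≤ (Real.exp (|24 * |β'| - 2| * |T|) * Real.exp ((2 - 24 * |β'|) * (τ : ℝ))) * (fderiv ℝ g' (coords y) (fun q : Edge 3 L × Fin (fundamentalLatticeRep 2).N × Fin (fundamentalLatticeRep 2).N × Bool => if n.1 = q.1 then (fun z : ℂ => if q.2.2.2 then z.im else z.re) (((Real.sqrt 2 : ℂ) • ((fundamentalLatticeRep 2).lieProj (noiseDir n.2) * (fun (ee : Edge 3 L) => Matrix.of fun (i j : Fin (fundamentalLatticeRep 2).N) => ((coords y (ee, i, j, false) : ℝ) : ℂ) + ((coords y (ee, i, j, true) : ℝ) : ℂ) * Complex.I) q.1)) q.2.1 q.2.2.1) else 0)) ^ 2 :=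
          le_mul_of_one_le_left hx0 hE
      _ = Real.exp (|24 * |β'| - 2| * |T|) * (Real.exp ((2 - 24 * |β'|) * (τ : ℝ)) * (fderiv ℝ g' (coords y) (fun q : Edge 3 L × Fin (fundamentalLatticeRep 2).N × Fin (fundamentalLatticeRep 2).N × Bool => if n.1 = q.1 then (fun z : ℂ => if q.2.2.2 then z.im else z.re) (((Real.sqrt 2 : ℂ) • ((fundamentalLatticeRep 2).lieProj (noiseDir n.2) * (fun (ee : Edge 3 L) => Matrix.of fun (i j : Fin (fundamentalLatticeRep 2).N) => ((coords y (ee, i, j, false) : ℝ) : ℂ) + ((coords y (ee, i, j, true) : ℝ) : ℂ) * Complex.I) q.1)) q.2.1 q.2.2.1) else 0)) ^ 2) := by ring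
      _ ≤ Real.exp (|24 * |β'| - 2| * |T|) * S := mul_le_mul_of_nonneg_left hexp (Real.exp_pos _).le
  exact Real.abs_le_sqrt hsq2

/-! ## §2. The fundamental theorem of calculus for frame derivatives along the semigroup -/

/-- ★★★ **Time-FTC for the frame derivatives of the semigroup.**  Let `f ∈ C³_c`, let `a ∈ C⁵_c` represent `𝓛f` on the group
(`a∘coords = 𝓛f`), and let `g_τ`, `v_τ` be ANY `C¹` representatives of `κ_τ(f∘coords)`, `κ_τ(a∘coords)` (`τ ≥ 0`).  Then for every
frame index `n`, every start `x` and `0 ≤ τ₁ ≤ τ₂`, the map `σ ↦ W_n v_σ(coords x)` is integrable on `[τ₁, τ₂]` and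
`W_n g_(τ₂)(coords x) − W_n g_(τ₁)(coords x) = ∫_(τ₁)^(τ₂) W_n v_σ(coords x) dσ`.
Proof: Dynkin's formula at the points of the one-parameter subgroup `h ↦ e^(hX_n)·x` gives
`κ_τ₂F − κ_τ₁F = ∫_(τ₁)^(τ₂) κ_σ(a∘coords) dσ` there; differentiate in `h` at `0` under the integral (the `h`-derivative of
`κ_σ(a∘coords)(e^(hX)·x)` is `W_n v_σ`, bounded uniformly by `abs_frameDeriv_transitionRep_le`, and measurable in `σ` as the derivative
of a jointly continuous function, `measurable_deriv_with_param`). [folklore] -/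
theorem frameDeriv_transition_sub_eq_integral (L : ℕ) [NeZero L] (β' : ℝ)
    (κ : ℝ≥0 → Kernel (GaugeConfig 3 L (Matrix.specialUnitaryGroup (Fin 2) ℂ))
      (GaugeConfig 3 L (Matrix.specialUnitaryGroup (Fin 2) ℂ))) [∀ t, IsMarkovKernel (κ t)]
    (hreal : ∀ (t : ℝ≥0) (x : GaugeConfig 3 L (Matrix.specialUnitaryGroup (Fin 2) ℂ))
        (Ω : Type) [MeasurableSpace Ω] (P : Measure Ω) [IsProbabilityMeasure P]
        (W : ℝ≥0 → Ω → (Edge 3 L × NoiseIdx 2 → ℝ)) (hW : IsFlatBrownian W P)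
        (U : ℝ≥0 → Ω → GaugeConfig 3 L (Matrix.specialUnitaryGroup (Fin 2) ℂ)),
        (∀ ω, U 0 ω = x) →
        (latticeLangevinDynamics (fundamentalLatticeRep 2) β').IsSolution (fundamentalRep (Fin 2))
          hW.natFiltration P W U →
        κ t x = P.map (U t))
    {f : (Edge 3 L × Fin 2 × Fin 2 × Bool → ℝ) → ℝ} (hf : ContDiff ℝ 3 f) (hfc : HasCompactSupport f)
    {a : (Edge 3 L × Fin 2 × Fin 2 × Bool → ℝ) → ℝ} (ha : ContDiff ℝ 5 a)
    (g v : ℝ≥0 → (Edge 3 L × Fin 2 × Fin 2 × Bool → ℝ) → ℝ) (hg : ∀ τ, ContDiff ℝ 1 (g τ)) (hv : ∀ τ, ContDiff ℝ 1 (v τ))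
    (n : Edge 3 L × NoiseIdx (fundamentalLatticeRep 2).N) (x : GaugeConfig 3 L (Matrix.specialUnitaryGroup (Fin 2) ℂ)) {τ₁ τ₂ : ℝ} (h0 : 0 ≤ τ₁) (h12 : τ₁ ≤ τ₂) :
    let coords : GaugeConfig 3 L (Matrix.specialUnitaryGroup (Fin 2) ℂ) → (Edge 3 L × Fin 2 × Fin 2 × Bool → ℝ) :=
      fun V q => (fun z : ℂ => if q.2.2.2 then z.im else z.re)
        ((fundamentalRep (Fin 2) (V q.1) : Matrix (Fin 2) (Fin 2) ℂ) q.2.1 q.2.2.1)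
    let gen : ((Edge 3 L × Fin 2 × Fin 2 × Bool → ℝ) → ℝ) → GaugeConfig 3 L (Matrix.specialUnitaryGroup (Fin 2) ℂ) → ℝ :=
      fun h V =>
      (∑ i : Edge 3 L × Fin 2 × Fin 2 × Bool, fderiv ℝ h (coords V) (Pi.single i 1) *
          (fun z : ℂ => if i.2.2.2 then z.im else z.re)
            ((latticeLangevinDynamics (fundamentalLatticeRep 2) β').drift
              (matrixConfig (fundamentalRep (Fin 2)) V) i.1 i.2.1 i.2.2.1) +
      1 / 2 * ∑ i : Edge 3 L × Fin 2 × Fin 2 × Bool, ∑ j : Edge 3 L × Fin 2 × Fin 2 × Bool,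
        fderiv ℝ (fun z => fderiv ℝ h z (Pi.single i 1)) (coords V) (Pi.single j 1) *
          ∑ n : Edge 3 L × NoiseIdx 2,
            (if n.1 = i.1 then (fun z : ℂ => if i.2.2.2 then z.im else z.re)
              ((latticeLangevinDynamics (fundamentalLatticeRep 2) β').noise
                (matrixConfig (fundamentalRep (Fin 2)) V) i.1 n.2 i.2.1 i.2.2.1) else 0) *
            (if n.1 = j.1 then (fun z : ℂ => if j.2.2.2 then z.im else z.re)
              ((latticeLangevinDynamics (fundamentalLatticeRep 2) β').noise
                (matrixConfig (fundamentalRep (Fin 2)) V) j.1 n.2 j.2.1 j.2.2.1) else 0))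
    (∀ y, a (coords y) = gen f y) →
    (∀ (τ : ℝ≥0) (y : GaugeConfig 3 L (Matrix.specialUnitaryGroup (Fin 2) ℂ)), ∫ z, f (coords z) ∂(κ τ y) = g τ (coords y)) →
    (∀ (τ : ℝ≥0) (y : GaugeConfig 3 L (Matrix.specialUnitaryGroup (Fin 2) ℂ)), ∫ z, a (coords z) ∂(κ τ y) = v τ (coords y)) →
    IntervalIntegrable (fun σ : ℝ => fderiv ℝ (v σ.toNNReal) (coords x) (fun q : Edge 3 L × Fin (fundamentalLatticeRep 2).N × Fin (fundamentalLatticeRep 2).N × Bool => if n.1 = q.1 then (fun z : ℂ => if q.2.2.2 then z.im else z.re) (((Real.sqrt 2 : ℂ) • ((fundamentalLatticeRep 2).lieProj (noiseDir n.2) * (fun (ee : Edge 3 L) => Matrix.of fun (i j : Fin (fundamentalLatticeRep 2).N) => ((coords x (ee, i, j, false) : ℝ) : ℂ) + ((coords x (ee, i, j, true) : ℝ) : ℂ) * Complex.I) q.1)) q.2.1 q.2.2.1) else 0)) volume τ₁ τ₂ ∧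
    fderiv ℝ (g τ₂.toNNReal) (coords x) (fun q : Edge 3 L × Fin (fundamentalLatticeRep 2).N × Fin (fundamentalLatticeRep 2).N × Bool => if n.1 = q.1 then (fun z : ℂ => if q.2.2.2 then z.im else z.re) (((Real.sqrt 2 : ℂ) • ((fundamentalLatticeRep 2).lieProj (noiseDir n.2) * (fun (ee : Edge 3 L) => Matrix.of fun (i j : Fin (fundamentalLatticeRep 2).N) => ((coords x (ee, i, j, false) : ℝ) : ℂ) + ((coords x (ee, i, j, true) : ℝ) : ℂ) * Complex.I) q.1)) q.2.1 q.2.2.1) else 0) - fderiv ℝ (g τ₁.toNNReal) (coords x) (fun q : Edge 3 L × Fin (fundamentalLatticeRep 2).N × Fin (fundamentalLatticeRep 2).N × Bool => if n.1 = q.1 then (fun z : ℂ => if q.2.2.2 then z.im else z.re) (((Real.sqrt 2 : ℂ) • ((fundamentalLatticeRep 2).lieProj (noiseDir n.2) * (fun (ee : Edge 3 L) => Matrix.of fun (i j : Fin (fundamentalLatticeRep 2).N) => ((coords x (ee, i, j, false) : ℝ) : ℂ) + ((coords x (ee, i, j, true) : ℝ) : ℂ) * Complex.I) q.1)) q.2.1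 q.2.2.1) else 0) =
      ∫ σ in τ₁..τ₂, fderiv ℝ (v σ.toNNReal) (coords x) (fun q : Edge 3 L × Fin (fundamentalLatticeRep 2).N × Fin (fundamentalLatticeRep 2).N × Bool => if n.1 = q.1 then (fun z : ℂ => if q.2.2.2 then z.im else z.re) (((Real.sqrt 2 : ℂ) • ((fundamentalLatticeRep 2).lieProj (noiseDir n.2) * (fun (ee : Edge 3 L) => Matrix.of fun (i j : Fin (fundamentalLatticeRep 2).N) => ((coords x (ee, i, j, false) : ℝ) : ℂ) + ((coords x (ee, i, j, true) : ℝ) : ℂ) * Complex.I) q.1)) q.2.1 q.2.2.1) else 0) := by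
  intro coords gen haf hgrep hvrep
  classical
  haveI := secondCountableTopology_su2
  haveI := borelSpace_config L
  have hco : Continuous coords := continuous_coords (L := L)
  have hτ₂ : 0 ≤ τ₂ := h0.trans h12
  -- the one-parameter subgroup `h ↦ e^(hX)·_(n.1) x` generated by the field `n`
  obtain ⟨X, hXdef⟩ : ∃ X : Matrix (Fin (fundamentalLatticeRep 2).N) (Fin (fundamentalLatticeRep 2).N) ℂ,
      X = (Real.sqrt 2 : ℂ) • (fundamentalLatticeRep 2).lieProj (noiseDir n.2) := ⟨_, rfl⟩
  have hX : Xᴴ = -X := by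
    rw [hXdef, Matrix.conjTranspose_smul, ← Matrix.star_eq_conjTranspose, (fundamentalLatticeRep 2).star_lieProj, Complex.star_def,
      Complex.conj_ofReal, smul_neg]
  have hX0 : X.trace = 0 := by
    rw [hXdef, Matrix.trace_smul, trace_eq_zero_of_mem_lieAlg_two ((fundamentalLatticeRep 2).lieProj_mem (noiseDir n.2)), smul_zero]
  have hγ0 : (Pi.mulSingle n.1 (SUNBakryEmery.expSU (N := 2) (Y := Matrix.of fun i j : Fin 2 => X i j) hX hX0 (0 : ℝ)) * x) = x := by
    have : (SUNBakryEmery.expSU (N := 2) (Y := Matrix.of fun i j : Fin 2 => X i j) hX hX0 (0 : ℝ)) = 1 :=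
      Subtype.ext (by rw [SUNBakryEmery.coe_expSU, zero_smul, NormedSpace.exp_zero]; rfl)
    rw [this, Pi.mulSingle_one, one_mul]
  have hγc : Continuous fun h : ℝ => (Pi.mulSingle n.1 (SUNBakryEmery.expSU (N := 2) (Y := Matrix.of fun i j : Fin 2 => X i j) hX hX0 h) * x) := by
    have hexp : Continuous fun s : ℝ => (SUNBakryEmery.expSU (N := 2) (Y := Matrix.of fun i j : Fin 2 => X i j) hX hX0 s) := by
      refine Continuous.subtype_mk ?_ _
      exact Literature.MathematicalPhysics.QuantumFieldTheory.continuous_exp_smul _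
    exact ((continuous_mulSingle n.1).comp hexp).mul continuous_const
  -- derivative of an ambient `C¹` function along the subgroup = its frame derivative `W_n`
  have hflow : ∀ (H : (Edge 3 L × Fin 2 × Fin 2 × Bool → ℝ) → ℝ), Differentiable ℝ H → ∀ h : ℝ,
      HasDerivAt (fun h : ℝ => H (coords (Pi.mulSingle n.1 (SUNBakryEmery.expSU (N := 2) (Y := Matrix.of fun i j : Fin 2 => X i j) hX hX0 h) * x))) (fderiv ℝ H (coords (Pi.mulSingle n.1 (SUNBakryEmery.expSU (N := 2) (Y := Matrix.of fun i j : Fin 2 => X i j) hX hX0 h) * x)) (fun q : Edge 3 L × Fin (fundamentalLatticeRep 2).N × Fin (fundamentalLatticeRep 2).N × Bool => if n.1 = q.1 then (fun z : ℂ => if q.2.2.2 then z.im else z.re) (((Real.sqrt 2 : ℂ) • ((fundamentalLatticeRep 2).lieProj (noiseDir n.2) * (fun (ee : Edge 3 L) => Matrix.of fun (i j : Fin (fundamentalLatticeRep 2).N) => ((coords (Pi.mulSingle n.1 (SUNBakryEmery.expSU (N := 2) (Y := Matrix.of fun i j : Fin 2 => X i j) hX hX0 h) * x) (ee, i, j,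 false) : ℝ) : ℂ) + ((coords (Pi.mulSingle n.1 (SUNBakryEmery.expSU (N := 2) (Y := Matrix.of fun i j : Fin 2 => X i j) hX hX0 h) * x) (ee, i, j, true) : ℝ) : ℂ) * Complex.I) q.1)) q.2.1 q.2.2.1) else 0)) h := by
    intro H hH h
    have hd := hasDerivAt_comp_coords_leftFlow (L := L) hX hX0 n.1 x hH h
    refine hd.congr_deriv ?_
    have e : (fun q : Edge 3 L × Fin (fundamentalLatticeRep 2).N × Fin (fundamentalLatticeRep 2).N × Bool => if n.1 = q.1 then (fun z : ℂ => if q.2.2.2 then z.im else z.re) ((X * (fun (ee : Edge 3 L) => Matrix.of fun (i j : Fin (fundamentalLatticeRep 2).N) => ((coords (Pi.mulSingle n.1 (SUNBakryEmery.expSU (N := 2) (Y := Matrix.of fun i j : Fin 2 => X i j) hX hX0 h) * x) (ee, i, j, false) : ℝ) : ℂ) + ((coords (Pi.mulSingle n.1 (SUNBakryEmery.expSU (N := 2) (Y := Matrix.of fun i j : Fin 2 => X i j) hX hX0 h) * x) (ee, i, j, true) : ℝ) : ℂ) * Complex.I) q.1) q.2.1 q.2.2.1) else 0) = (fun q : Edge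 3 L × Fin (fundamentalLatticeRep 2).N × Fin (fundamentalLatticeRep 2).N × Bool => if n.1 = q.1 then (fun z : ℂ => if q.2.2.2 then z.im else z.re) (((Real.sqrt 2 : ℂ) • ((fundamentalLatticeRep 2).lieProj (noiseDir n.2) * (fun (ee : Edge 3 L) => Matrix.of fun (i j : Fin (fundamentalLatticeRep 2).N) => ((coords (Pi.mulSingle n.1 (SUNBakryEmery.expSU (N := 2) (Y := Matrix.of fun i j : Fin 2 => X i j) hX hX0 h) * x) (ee, i, j, false) : ℝ) : ℂ) + ((coords (Pi.mulSingle n.1 (SUNBakryEmery.expSU (N := 2) (Y := Matrix.of fun i j : Fin 2 => X i j) hX hX0 h) * x) (ee, i, j, true) : ℝ) : ℂ) * Complex.I) q.1)) q.2.1 q.2.2.1) else 0) := by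
      funext q; simp only [hXdef, Matrix.smul_mul]
    exact congrArg (fderiv ℝ H (coords (Pi.mulSingle n.1 (SUNBakryEmery.expSU (N := 2) (Y := Matrix.of fun i j : Fin 2 => X i j) hX hX0 h) * x))) e
  -- the kernel action of `a∘coords` along the subgroup, jointly continuous in `(σ, h)`
  have cA : Continuous fun z : GaugeConfig 3 L (Matrix.specialUnitaryGroup (Fin 2) ℂ) => a (coords z) := ha.continuous.comp hco
  obtain ⟨p, hp⟩ : ∃ p : ℝ → ℝ → ℝ, p = fun σ h => ∫ z, a (coords z) ∂(κ σ.toNNReal (Pi.mulSingle n.1 (SUNBakryEmery.expSU (N := 2) (Y := Matrix.of fun i j : Fin 2 => X i j) hX hX0 h) * x)) := ⟨_, rfl⟩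
  have hpc : Continuous (Function.uncurry p) := by
    rw [hp]
    exact (continuous_transitionKernel_action (L := L) β' κ hreal cA).comp
      ((continuous_real_toNNReal.comp continuous_fst).prodMk (hγc.comp continuous_snd))
  have hpv : ∀ σ h, p σ h = v σ.toNNReal (coords (Pi.mulSingle n.1 (SUNBakryEmery.expSU (N := 2) (Y := Matrix.of fun i j : Fin 2 => X i j) hX hX0 h) * x)) := fun σ h => by rw [hp]; exact hvrep _ _
  have hpσ : ∀ h, Continuous fun σ => p σ h := fun h => hpc.comp (continuous_id.prodMk continuous_const)
  -- Dynkin along the subgroup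
  have hdyn : ∀ (h : ℝ) {τ : ℝ}, 0 ≤ τ → g τ.toNNReal (coords (Pi.mulSingle n.1 (SUNBakryEmery.expSU (N := 2) (Y := Matrix.of fun i j : Fin 2 => X i j) hX hX0 h) * x)) = f (coords (Pi.mulSingle n.1 (SUNBakryEmery.expSU (N := 2) (Y := Matrix.of fun i j : Fin 2 => X i j) hX hX0 h) * x)) + ∫ r in (0:ℝ)..τ, p r h := by
    intro h τ hτ
    have hD : ∫ z, f (coords z) ∂(κ τ.toNNReal (Pi.mulSingle n.1 (SUNBakryEmery.expSU (N := 2) (Y := Matrix.of fun i j : Fin 2 => X i j) hX hX0 h) * x)) = f (coords (Pi.mulSingle n.1 (SUNBakryEmery.expSU (N := 2) (Y := Matrix.of fun i j : Fin 2 => X i j) hX hX0 h) * x)) + ∫ r in (0:ℝ)..τ, ∫ z, gen f z ∂(κ r.toNNReal (Pi.mulSingle n.1 (SUNBakryEmery.expSU (N := 2) (Y := Matrix.of fun i j : Fin 2 => X i j) hX hX0 h) * x)) :=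
      transitionKernel_dynkin (L := L) β' κ hreal hf hfc (Pi.mulSingle n.1 (SUNBakryEmery.expSU (N := 2) (Y := Matrix.of fun i j : Fin 2 => X i j) hX hX0 h) * x) hτ
    rw [hgrep] at hD
    rw [hD, hp]
    congr 1
    refine intervalIntegral.integral_congr fun r _ => ?_
    exact integral_congr_ae (ae_of_all _ fun z => (haf z).symm)
  have hdiffQ : ∀ h : ℝ, g τ₂.toNNReal (coords (Pi.mulSingle n.1 (SUNBakryEmery.expSU (N := 2) (Y := Matrix.of fun i j : Fin 2 => X i j) hX hX0 h) * x)) - g τ₁.toNNReal (coords (Pi.mulSingle n.1 (SUNBakryEmery.expSU (N := 2) (Y := Matrix.of fun i j : Fin 2 => X i j) hX hX0 h) * x)) = ∫ r in τ₁..τ₂, p r h := by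
    intro h
    rw [hdyn h hτ₂, hdyn h h0, add_sub_add_left_eq_sub,
      intervalIntegral.integral_interval_sub_left ((hpσ h).intervalIntegrable _ _) ((hpσ h).intervalIntegrable _ _)]
  -- the uniform bound on the `h`-derivatives
  obtain ⟨M, hM0, hM⟩ := abs_frameDeriv_transitionRep_le L β' κ hreal ha τ₂
  -- differentiate under the integral sign at `h = 0`
  obtain ⟨F', hF'⟩ : ∃ F' : ℝ → ℝ → ℝ, F' = fun h r => fderiv ℝ (v r.toNNReal) (coords (Pi.mulSingle n.1 (SUNBakryEmery.expSU (N := 2) (Y := Matrix.of fun i j : Fin 2 => X i j) hX hX0 h) * x)) (fun q : Edge 3 L × Fin (fundamentalLatticeRep 2).N × Fin (fundamentalLatticeRep 2).N × Bool => if n.1 = q.1 then (fun z : ℂ => if q.2.2.2 then z.im else z.re) (((Real.sqrt 2 : ℂ) • ((fundamentalLatticeRep 2).lieProj (noiseDir n.2) * (fun (ee : Edge 3 L) => Matrix.of fun (i j : Fin (fundamentalLatticeRep 2).N) => ((coords (Pi.mulSingle n.1 (SUNBakryEmery.expSU (N := 2) (Y := Matrix.of fun i j : Fin 2 => X i j)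 hX hX0 h) * x) (ee, i, j, false) : ℝ) : ℂ) + ((coords (Pi.mulSingle n.1 (SUNBakryEmery.expSU (N := 2) (Y := Matrix.of fun i j : Fin 2 => X i j) hX hX0 h) * x) (ee, i, j, true) : ℝ) : ℂ) * Complex.I) q.1)) q.2.1 q.2.2.1) else 0) := ⟨_, rfl⟩
  have hdiff : ∀ r h, HasDerivAt (fun h => p r h) (F' h r) h := by
    intro r h
    have e : (fun h => p r h) = fun h => v r.toNNReal (coords (Pi.mulSingle n.1 (SUNBakryEmery.expSU (N := 2) (Y := Matrix.of fun i j : Fin 2 => X i j) hX hX0 h) * x)) := funext fun h => hpv r h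
    rw [e, hF']
    exact hflow (v r.toNNReal) ((hv _).differentiable (by norm_num)) h
  have hkey := (intervalIntegral.hasDerivAt_integral_of_dominated_loc_of_deriv_le (μ := volume) (a := τ₁) (b := τ₂)
      (F := fun h r => p r h) (F' := F') (x₀ := (0 : ℝ)) (s := Set.univ) (bound := fun _ => M) Filter.univ_mem
      (Filter.Eventually.of_forall fun h => ((hpσ h).aestronglyMeasurable).restrict)
      ((hpσ 0).intervalIntegrable _ _) ?_ ?_ intervalIntegrable_const ?_)
  rotate_left
  · -- measurability of `r ↦ F' 0 r`: it is the `h`-derivative at `0` of the jointly continuous `p`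
    have hmeas : Measurable fun r : ℝ => deriv (fun h => p r h) 0 :=
      (measurable_deriv_with_param hpc).comp (measurable_id.prodMk measurable_const)
    have e : F' 0 = fun r => deriv (fun h => p r h) 0 := funext fun r => ((hdiff r 0).deriv).symm
    rw [e]
    exact hmeas.aestronglyMeasurable
  · refine ae_of_all _ fun r hr h _ => ?_
    rw [hF', Real.norm_eq_abs]
    have hr2 : ((r.toNNReal : ℝ≥0) : ℝ) ≤ τ₂ := by
      rw [Real.coe_toNNReal']
      exact max_le (by rcases Set.mem_uIoc.1 hr with h' | h' <;> linarith [h'.2, h'.1]) hτ₂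
    exact hM r.toNNReal hr2 (v r.toNNReal) (hv _) (fun y => hvrep _ y) n (Pi.mulSingle n.1 (SUNBakryEmery.expSU (N := 2) (Y := Matrix.of fun i j : Fin 2 => X i j) hX hX0 h) * x)
  · exact ae_of_all _ fun r _ h _ => hdiff r h
  obtain ⟨hint, hder⟩ := hkey
  -- the two `h`-derivatives at `0` and uniqueness
  have hQ : HasDerivAt (fun h : ℝ => g τ₂.toNNReal (coords (Pi.mulSingle n.1 (SUNBakryEmery.expSU (N := 2) (Y := Matrix.of fun i j : Fin 2 => X i j) hX hX0 h) * x)) - g τ₁.toNNReal (coords (Pi.mulSingle n.1 (SUNBakryEmery.expSU (N := 2) (Y := Matrix.of fun i j : Fin 2 => X i j) hX hX0 h) * x)))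
      (fderiv ℝ (g τ₂.toNNReal) (coords (Pi.mulSingle n.1 (SUNBakryEmery.expSU (N := 2) (Y := Matrix.of fun i j : Fin 2 => X i j) hX hX0 (0 : ℝ)) * x)) (fun q : Edge 3 L × Fin (fundamentalLatticeRep 2).N × Fin (fundamentalLatticeRep 2).N × Bool => if n.1 = q.1 then (fun z : ℂ => if q.2.2.2 then z.im else z.re) (((Real.sqrt 2 : ℂ) • ((fundamentalLatticeRep 2).lieProj (noiseDir n.2) * (fun (ee : Edge 3 L) => Matrix.of fun (i j : Fin (fundamentalLatticeRep 2).N) => ((coords (Pi.mulSingle n.1 (SUNBakryEmery.expSU (N := 2) (Y := Matrix.of fun i j : Fin 2 => X i j) hX hX0 (0 : ℝ)) * x) (ee, i, j, false) : ℝ) : ℂ) + ((coords (Pi.mulSingle n.1 (SUNBakryEmery.expSU (N := 2) (Y := Matrix.of fun i j : Fin 2 => X i j) hX hX0 (0 : ℝ)) * x) (ee, i, j, true) : ℝ) : ℂ) * Complex.I) q.1)) q.2.1 q.2.2.1) else 0) - fderiv ℝ (g τ₁.toNNReal) (coords (Pi.mulSingle n.1 (SUNBakryEmery.expSU (N :=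 2) (Y := Matrix.of fun i j : Fin 2 => X i j) hX hX0 (0 : ℝ)) * x)) (fun q : Edge 3 L × Fin (fundamentalLatticeRep 2).N × Fin (fundamentalLatticeRep 2).N × Bool => if n.1 = q.1 then (fun z : ℂ => if q.2.2.2 then z.im else z.re) (((Real.sqrt 2 : ℂ) • ((fundamentalLatticeRep 2).lieProj (noiseDir n.2) * (fun (ee : Edge 3 L) => Matrix.of fun (i j : Fin (fundamentalLatticeRep 2).N) => ((coords (Pi.mulSingle n.1 (SUNBakryEmery.expSU (N := 2) (Y := Matrix.of fun i j : Fin 2 => X i j) hX hX0 (0 : ℝ)) * x) (ee, i, j, false) : ℝ) : ℂ) + ((coords (Pi.mulSingle n.1 (SUNBakryEmery.expSU (N := 2) (Y := Matrix.of fun i j : Fin 2 => X i j) hX hX0 (0 : ℝ)) * x) (ee, i, j, true) : ℝ) : ℂ) * Complex.I) q.1)) q.2.1 q.2.2.1) else 0)) 0 :=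
    (hflow (g τ₂.toNNReal) ((hg _).differentiable (by norm_num)) 0).sub (hflow (g τ₁.toNNReal) ((hg _).differentiable (by norm_num)) 0)
  have hI : HasDerivAt (fun h : ℝ => g τ₂.toNNReal (coords (Pi.mulSingle n.1 (SUNBakryEmery.expSU (N := 2) (Y := Matrix.of fun i j : Fin 2 => X i j) hX hX0 h) * x)) - g τ₁.toNNReal (coords (Pi.mulSingle n.1 (SUNBakryEmery.expSU (N := 2) (Y := Matrix.of fun i j : Fin 2 => X i j) hX hX0 h) * x))) (∫ r in τ₁..τ₂, F' 0 r) 0 :=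
    hder.congr_of_eventuallyEq (Filter.Eventually.of_forall fun h => hdiffQ h)
  have huniq := hQ.unique hI
  rw [hF'] at hint huniq
  simp only [hγ0] at hint huniq
  exact ⟨hint, huniq⟩


end Summit.QuantumFields.YangMills.Theorems.ColdStartUniversality
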